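import Summits.ResolutionOfSingularities.ResolutionOfSingularities.Theorems.EquisingularLiftEquisingularLiftNatUncentredConeGerm
import Summits.ResolutionOfSingularities.ResolutionOfSingularities.Theorems.EquisingularLiftEquisingularLiftNatCarrierDeltaOfPresentation
import Summits.ResolutionOfSingularities.ResolutionOfSingularities.Theorems.EquisingularLiftEquisingularLiftNatBlowupChartPointInjective
import Summits.ResolutionOfSingularities.ResolutionOfSingularities.Theorems.EquisingularLiftEquisingularLiftNatModelStep
import HarnessLib

/-!
# [OURS · L1 W4.5(b) · EL♮(3)] HSUB(ReachTC⁺)₃ brick `inv_base`, sub-brick B5: MEMBER CLAUSE (v) OFF THE CONE POINT for the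
# CENTRED member — regular quotient stalks of codimension `2` at every special point `z ≠ j₂ y′` of the Δ-centre `E ⊔ St_{τ₁} K₀`

Crux chain w45b (cell `res-hironaka`, slot W4.5(b)), working crux **EL♮** = stmt-ResolutionOfSingularities-20038, child
**EL♮(3)** = stmt-ResolutionOfSingularities-20148, route EquisingularLift, line `sections`, registered stub
`stub_elnat_tcPlusPointResolution`; assembly HSUB(ReachTC⁺)₃ (driver `hsub_reachTCPlus_of_invariant` p526242, INV DEFS v3
p532383, `TCPlus.Member` clause (v)); brick `inv_base` (res-type-100), sub-brick **B5** dealt to res-L1-w45b-stub-2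
(res-L1-w45b-plan-1 RULING 2026-08-27T14:38:30Z (R-A); res-type-100 SHED + literal interface 14:44:17Z). HONEST FRAMING: OURS;
NOT a statement of any manuscript; AI-written, weaker than expert review. No `sorry`; standard axioms. DEF-FREE.
`--supports stmt-ResolutionOfSingularities-20148 --as helper`.

WHAT.
* `isRegularLocalRing_stalk_quotient_carrierDelta_of_generator` — (v) ON A GOOD CHART (any blowing up, any frame length `r`):
  if `π♯(c_l)` generates the exceptional stalk at `x'` and the Δ-criterion holds on the chart `c_l` (F3b′ currency of
  res-type-100's p535966), then `𝒪_{X',x'} ⧸ (St K ⊔ E)_{x'}` is regular — B1★ (res-D-pv-029 p537631, prescribed chart) ∘ F3b′.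
* `span_singleton_eq_span_singleton_of_map_eq` — transfer of a generator UP a local homomorphism: `a ∈ (t)`, `f (t) = (f a) ≠ 0`
  ⇒ `(t) = (a)`; whence `stalkIdeal_eq_span_of_comap_eq_span` — a generator of `(E·𝒪_{F₂})_w` that comes from `E_{j₂ w}`
  generates `E_{j₂ w}` (model square `j₂ : F₂ → X₁`, `E` and `E·𝒪_{F₂}` effective Cartier).
* **`isRegularLocalRing_quotient_carrierDelta_of_ne_conePoint`** — B5 in res-type-100's literal interface (the binders of the
  driver's point step at `n = 3`; the frame `c` at `j x` with `θR`, the CENTRED cone form `Φ ∈ O[T₀,T₁,T₂]_d` of their B4a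
  `exists_centredConeLift_three` with its Δ-clause on the charts `i ≠ 0` in the kit's `ρ`-form, ANY cone ideal sheaf `K₀` with
  germ `(ι_*Φ)(c)`, and the DOWNSTAIRS T-FRAME-AT presentation of the cone point `y′ = [1:0:0]`): at every point `z` of
  `supp (E ⊔ St_{τ₁} K₀)` over the closed point with `z ≠ j₂ y′`, `𝒪_{X₁,z} ⧸ (E ⊔ St K₀)_z` is a regular local ring and
  `dim 𝒪_{X₁,z} ⧸ (E ⊔ St K₀)_z + 2 = dim 𝒪_{X₁,z}`. ROUTE: `z = j₂ w` (special points lie on the special fibre), `w ≠ y′`,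
  `υ w = x`; DOWNSTAIRS `w` is off the vertex of the frame `c̄ = j♯ c` of `𝔪_x`, so some `c̄_l`, `l ≠ 0`, generates `(𝔪_x·𝒪_{F₂})_w`
  (T-PTPRIME-DICT 3 `exists_generator_ne_of_ne_vertex` on the blow-up `υ` of `x`); transfer UP the model square
  (`(E·𝒪_{F₂}) = 𝔪_x·𝒪_{F₂}`, `hcarrier`): `τ₁♯(c_l)` generates `E_z`; then (v) on the chart `c_l` and the codimension by
  res-type-100's `ringKrullDim_quotient_carrierDelta_add_two`.

References (index only): res-L1-w45b-stub-1 HSUB-TCPLUS3-skeleton / INV DEFS v3 (OURS planning texts); res-type-100 STATUS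
2026-08-27T13:39:56Z (B-decomposition), 14:44:17Z (interface).
-/

set_option linter.dupNamespace false -- mandated namespace `Summit.<Summit>.<Problem>` of this single-conjunct summit
set_option linter.overlappingInstances false -- the binders carry `[IsDomain O] [IsDiscreteValuationRing O]`

noncomputable section

open CategoryTheory CategoryTheory.Limits AlgebraicGeometry TopologicalSpace IsLocalRing
open Literature.AlgebraicGeometry.Resolution
open AlgebraicGeometry.Scheme.IdealSheafData
open Summit.ResolutionOfSingularities.ResolutionOfSingularities.Cruxes.EquisingularLift.StrataSplit

namespace Summit.ResolutionOfSingularities.ResolutionOfSingularities.Cruxes.EquisingularLiftNat.Sections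

universe u

/-! ## 1. Clause (v) on a good chart -/

section GoodChart

variable {X X' : Scheme.{u}} {τ : X' ⟶ X} {J : X.IdealSheafData}

/-- B1★ (res-D-pv-029's `exists_blowupAlgebra_stalk_ringEquiv_of_stalkIdeal_eq_span`) for a frame given AT `p = τ x'`
(`stalkCongr` currency). [cite: StacksProject, Tag 0804] -/
theorem exists_prescribedChartPresentation_of_eq (hτ : IsBlowup τ J) (x' : X') {p : X} (hp : τ x' = p) {r : ℕ}
    (c : Fin r → X.presheaf.stalk p) (hcJ : Ideal.span (Set.range c) = stalkIdeal J p) (l : Fin r)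
    (hl : stalkIdeal (J.comap τ) x' = Ideal.span {((X.presheaf.stalkCongr (.of_eq hp)).inv ≫ τ.stalkMap x').hom (c l)}) :
    ∃ (𝔔 : PrimeSpectrum (blowupAlgebra (Ideal.span (Set.range c)) (c l)))
      (χ : blowupAlgebra (Ideal.span (Set.range c)) (c l) →+* X'.presheaf.stalk x'),
      (∀ a, χ (algebraMap _ _ a) = ((X.presheaf.stalkCongr (.of_eq hp)).inv ≫ τ.stalkMap x').hom a) ∧
      @IsLocalization.AtPrime _ _ (X'.presheaf.stalk x') _ χ.toAlgebra 𝔔.asIdeal _ ∧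
      𝔔.asIdeal.comap (algebraMap _ (blowupAlgebra (Ideal.span (Set.range c)) (c l))) = maximalIdeal (X.presheaf.stalk p) := by
  subst hp
  have hself : ∀ a, ((X.presheaf.stalkCongr (.of_eq (rfl : τ x' = τ x'))).inv ≫ τ.stalkMap x').hom a =
      (τ.stalkMap x').hom a := fun a => by
    rw [CommRingCat.comp_apply, TopCat.Presheaf.stalkCongr_inv]
    congr 1
    exact stalkSpecializes_self_apply X.presheaf (τ x') _ a
  rw [hself] at hl
  obtain ⟨𝔔, χ, -, hχ, hloc, -, h𝔔⟩ := exists_blowupAlgebra_stalk_ringEquiv_of_stalkIdeal_eq_span hτ x' c hcJ l hl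
  exact ⟨𝔔, χ, fun a => (hχ a).trans (hself a).symm, hloc, h𝔔⟩

set_option maxHeartbeats 400000 in -- the chart algebra `blowupAlgebra` is a subalgebra of a localisation: slow instance unification (cf. p535966)
/-- **Clause (v) on a good chart.** In the setting of res-type-100's F3b′ (`isRegularLocalRing_stalk_quotient_carrierDelta_of_presentation`):
`τ : X' → X` a blowing up along `J`, `τ x' = p ∈ supp J`, `J_p = (c)` with `c` quasi-regular and `R/(c)` a domain, `K_p = (Φ(c))` for a form
`Φ` of degree `d` with `Φ mod (c) ≠ 0`, `ϖ_R` the germ of a global section `v` in `𝔪_p`, `θ : R/(c) ≅ Λ`. IF `τ♯(c_l)` generates the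
exceptional stalk at `x'` and the Δ-criterion holds on the chart `c_l`, THEN `𝒪_{X',x'} ⧸ (St K ⊔ E)_{x'}` is a regular local ring
(prescribed-chart presentation B1★, then F3b′). [cite: Matsumura1987, Thm. 14.2; StacksProject, Tag 0804] -/
theorem isRegularLocalRing_stalk_quotient_carrierDelta_of_generator [IsLocallyNoetherian X'] (hτ : IsBlowup τ J)
    (K : X.IdealSheafData) (x' : X') (p : X) (hp : τ x' = p) (hpJ : p ∈ (J.support : Set X)) {r : ℕ}
    (c : Fin r → X.presheaf.stalk p) (hcJ : Ideal.span (Set.range c) = stalkIdeal J p)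
    (hc : IsQuasiRegular c) [IsDomain (X.presheaf.stalk p ⧸ Ideal.span (Set.range c))]
    {d : ℕ} (Φ : MvPolynomial (Fin r) (X.presheaf.stalk p)) (hΦd : Φ.IsHomogeneous d)
    (hΦ : MvPolynomial.map (Ideal.Quotient.mk (Ideal.span (Set.range c))) Φ ≠ 0)
    (hK : stalkIdeal K p = Ideal.span {MvPolynomial.eval c Φ}) (v : Γ(X, ⊤))
    (hϖ𝔪 : (X.presheaf.Γgerm p).hom v ∈ maximalIdeal (X.presheaf.stalk p))
    {Λ : Type u} [CommRing Λ] (θ : (X.presheaf.stalk p ⧸ Ideal.span (Set.range c)) ≃+* Λ) (l : Fin r)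
    (hl : stalkIdeal (J.comap τ) x' = Ideal.span {((X.presheaf.stalkCongr (.of_eq hp)).inv ≫ τ.stalkMap x').hom (c l)})
    (hreg : ∀ (𝔓 : Ideal (MvPolynomial {l' : Fin r // l' ≠ l} Λ ⧸ Ideal.span {MvPolynomial.map
        (θ.toRingHom.comp (Ideal.Quotient.mk (Ideal.span (Set.range c)))) (dehomogenize l Φ)})) [𝔓.IsPrime],
      Ideal.Quotient.mk _ (MvPolynomial.C (θ (Ideal.Quotient.mk _ ((X.presheaf.Γgerm p).hom v)))) ∈ 𝔓 →
        IsRegularLocalRing (Localization.AtPrime 𝔓))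
    (hx' : x' ∈ (strictTransformIdeal τ J K ⊔ J.comap τ).support) :
    IsRegularLocalRing (X'.presheaf.stalk x' ⧸ stalkIdeal (strictTransformIdeal τ J K ⊔ J.comap τ) x') := by
  obtain ⟨𝔔, χ, hχ, hloc, h𝔔⟩ := exists_prescribedChartPresentation_of_eq hτ x' hp c hcJ l hl
  exact isRegularLocalRing_stalk_quotient_carrierDelta_of_presentation K x' p hp hpJ c hcJ hc Φ hΦd hΦ hK v hϖ𝔪 θ l 𝔔 χ hχ
    hloc h𝔔 hreg hx'

end GoodChart

/-! ## 2. Transfer of a generator up a local homomorphism / up the model square -/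

/-- **Transfer of a generator up a local homomorphism.** `f : A → B` a local homomorphism of local rings, `a ∈ (t)`, and
`f (t) = (f a)`, `(f t) ≠ 0` (as ideals of `B`). Then `(t) = (a)`: writing `a = u t`, if `u` were a non-unit then
`f t ∈ f(u) · (f t)` with `f u ∈ 𝔪_B` would force `f t = 0`. [folklore] -/
theorem span_singleton_eq_span_singleton_of_map_eq {A B : Type*} [CommRing A] [CommRing B] [IsLocalRing A] [IsLocalRing B]
    (f : A →+* B) [IsLocalHom f] {t a : A} (ha : a ∈ Ideal.span {t})
    (hmap : (Ideal.span {t}).map f = Ideal.span {f a}) (hne : Ideal.span {f t} ≠ ⊥) :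
    Ideal.span {t} = Ideal.span {a} := by
  obtain ⟨u, rfl⟩ := Ideal.mem_span_singleton'.mp ha
  by_cases hu : IsUnit u
  · exact (Ideal.span_singleton_mul_left_unit hu t).symm
  · exfalso
    apply hne
    rw [Ideal.map_span, Set.image_singleton] at hmap
    have hft : f t ∈ Ideal.span {f (u * t)} := hmap ▸ Ideal.mem_span_singleton_self (f t)
    obtain ⟨v, hv⟩ := Ideal.mem_span_singleton'.mp hft
    have hfu : f u ∈ nonunits B := fun h => hu (IsUnit.of_map f u h)
    have h1 : IsUnit (1 - v * f u) :=
      isUnit_one_sub_self_of_mem_nonunits _ (mul_mem_nonunits_right hfu)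
    have h2 : (1 - v * f u) * f t = 0 := by
      rw [sub_mul, one_mul, mul_assoc, ← map_mul, hv, sub_self]
    have h3 : f t = 0 := by
      simpa using (h1.mul_right_eq_zero).mp h2
    rw [h3, Ideal.span_singleton_eq_bot]

/-- Moving a germ along `𝒪_{X,p} ≅ 𝒪_{X,y}` (`y = p`) keeps it inside the stalks of an ideal sheaf. [folklore] -/
theorem stalkCongr_inv_mem_stalkIdeal {Y : Scheme.{u}} (K : Y.IdealSheafData) {y p : Y} (h : y = p)
    {a : Y.presheaf.stalk p} (ha : a ∈ stalkIdeal K p) : (Y.presheaf.stalkCongr (.of_eq h)).inv a ∈ stalkIdeal K y := by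
  subst h
  rw [TopCat.Presheaf.stalkCongr_inv, stalkSpecializes_self_apply Y.presheaf y _ a]
  exact ha

/-- **Stalk maps around a commutative square of schemes.** For `j₂ ≫ τ₁ = υ ≫ j` and a point `w`, with `τ₁ (j₂ w) = j (υ w)`:
`j₂♯_w (τ₁♯_{j₂ w} a) = υ♯_w (j♯_{υ w} a)` for `a ∈ 𝒪_{X',j (υ w)}` (read at `τ₁ (j₂ w)` through the canonical identification).
[folklore] -/
theorem stalkMap_stalkMap_apply_of_comm_sq {X' X₁ F₁ F₂ : Scheme.{u}} (τ₁ : X₁ ⟶ X') (j : F₁ ⟶ X') (j₂ : F₂ ⟶ X₁)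
    (υ : F₂ ⟶ F₁) (hcomm : j₂ ≫ τ₁ = υ ≫ j) (w : F₂) (hzp : τ₁ (j₂ w) = j (υ w)) (a : X'.presheaf.stalk (j (υ w))) :
    (j₂.stalkMap w).hom (((X'.presheaf.stalkCongr (.of_eq hzp)).inv ≫ τ₁.stalkMap (j₂ w)).hom a) =
      (υ.stalkMap w).hom ((j.stalkMap (υ w)).hom a) := by
  -- adapted from res-L1-w45b-stub-1's `comap_strictTransformIdeal_eq_of_model` (…NatStrictTransformComap, `hcoef`)
  have h1 : (j₂ ≫ τ₁).stalkMap w = (X'.presheaf.stalkCongr (.of_eq (by rw [hcomm]))).hom ≫ (υ ≫ j).stalkMap w :=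
    Scheme.Hom.stalkMap_congr_hom _ _ hcomm w
  have h2 : ∀ z, (j₂.stalkMap w).hom ((τ₁.stalkMap (j₂ w)).hom z) = ((j₂ ≫ τ₁).stalkMap w).hom z := fun z => by
    rw [Scheme.Hom.stalkMap_comp]; rfl
  have h3 : ((X'.presheaf.stalkCongr (.of_eq (by rw [hcomm]) : Inseparable ((j₂ ≫ τ₁) w) ((υ ≫ j) w))).hom)
      ((X'.presheaf.stalkCongr (Inseparable.of_eq hzp)).inv a) = a := by
    change ((X'.presheaf.stalkCongr (Inseparable.of_eq hzp)).inv ≫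
      (X'.presheaf.stalkCongr (Inseparable.of_eq hzp)).hom) a = a
    rw [Iso.inv_hom_id]; rfl
  have h4 : ∀ b, ((υ ≫ j).stalkMap w).hom b = (υ.stalkMap w).hom ((j.stalkMap (υ w)).hom b) := fun b => by
    rw [Scheme.Hom.stalkMap_comp]; rfl
  rw [CommRingCat.comp_apply, h2, h1, CommRingCat.hom_comp, RingHom.comp_apply, ← h4]
  exact congrArg _ h3

/-- **A generator of the exceptional stalk downstairs that comes from upstairs generates upstairs.** In a commutative square
`j₂ ≫ τ₁ = υ ≫ j` with `E·𝒪_{F₂} = E₂` (`hcarrier`) for effective Cartier divisors `E` on `X₁` (the exceptional divisor of the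
blowing up `τ₁` along `J`) and `E₂` on `F₂`: if `J_{j (υ w)} ∋ a` and `υ♯ j♯ a` generates `(E₂)_w`, then `τ₁♯ a` generates
`E_{j₂ w}`. [folklore] -/
theorem stalkIdeal_eq_span_of_comap_eq_span {X' X₁ F₁ F₂ : Scheme.{u}} {τ₁ : X₁ ⟶ X'} {J : X'.IdealSheafData}
    (hτ₁ : IsBlowup τ₁ J) (j : F₁ ⟶ X') (j₂ : F₂ ⟶ X₁) (υ : F₂ ⟶ F₁) (hcomm : j₂ ≫ τ₁ = υ ≫ j)
    {E₂ : F₂.IdealSheafData} (hE₂ : IsEffectiveCartier E₂) (hcarrier : (J.comap τ₁).comap j₂ = E₂)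
    (w : F₂) (hzp : τ₁ (j₂ w) = j (υ w)) {a : X'.presheaf.stalk (j (υ w))} (ha : a ∈ stalkIdeal J (j (υ w)))
    (hgen : stalkIdeal E₂ w = Ideal.span {(υ.stalkMap w).hom ((j.stalkMap (υ w)).hom a)}) :
    stalkIdeal (J.comap τ₁) (j₂ w) = Ideal.span {((X'.presheaf.stalkCongr (.of_eq hzp)).inv ≫ τ₁.stalkMap (j₂ w)).hom a} := by
  obtain ⟨tt, htt0, htt⟩ := hτ₁.isEffectiveCartier.exists_stalkIdeal_eq_span (j₂ w)
  obtain ⟨t₂, ht₂0, ht₂⟩ := hE₂.exists_stalkIdeal_eq_span w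
  -- `a₁ = τ₁♯ a ∈ E_{j₂ w} = (tt)`
  have ha₁ : ((X'.presheaf.stalkCongr (.of_eq hzp)).inv ≫ τ₁.stalkMap (j₂ w)).hom a ∈ stalkIdeal (J.comap τ₁) (j₂ w) := by
    rw [stalkIdeal_comap_eq_map_stalkMap, CommRingCat.comp_apply]
    exact Ideal.mem_map_of_mem _ (stalkCongr_inv_mem_stalkIdeal J hzp ha)
  -- downstairs: `j₂♯ (E_{j₂ w}) = (E₂)_w = (j₂♯ a₁)`
  have hdown : (stalkIdeal (J.comap τ₁) (j₂ w)).map (j₂.stalkMap w).hom = stalkIdeal E₂ w := by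
    rw [← stalkIdeal_comap_eq_map_stalkMap, hcarrier]
  rw [htt] at ha₁ hdown ⊢
  refine span_singleton_eq_span_singleton_of_map_eq (j₂.stalkMap w).hom ha₁ ?_ ?_
  · rw [hdown, hgen, stalkMap_stalkMap_apply_of_comm_sq τ₁ j j₂ υ hcomm w hzp a]
  · rw [← Set.image_singleton, ← Ideal.map_span, hdown, ht₂]
    exact fun h => nonZeroDivisors.ne_zero ht₂0 (Ideal.span_singleton_eq_bot.mp h)

/-! ## 3. B5: clause (v) off the cone point, in res-type-100's interface -/

set_option maxHeartbeats 400000 in -- the chart algebra `blowupAlgebra` is a subalgebra of a localisation: slow instance unification (cf. p535966)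
/-- **MEMBER CLAUSE (v) OFF THE CONE POINT for the CENTRED member of `inv_base`.** Binders: the driver's point step at relative
dimension `3` — the model square `j : F₁ → X'` over the DVR `O ↠ k`, the section `s` with `s(s₀) = j x`, the blow-up `τ₁` of the
section with its model square `j₂ : F₂ → X₁` over the point blow-up `υ` of `x` (`hcomm`, `hcarrier`); the frame `c` at `j x` with
`θR : 𝒪/(c) ≅ O` (identity on constants) and `(c) + (ϖ) = 𝔪`, `ϖ ∉ (c)` for every uniformizer; a cone form `Φ ∈ O[T₀,T₁,T₂]_d`
with `ι_*Φ ≢ 0 mod (c)` and the Δ-clause ON THE CHARTS `i ≠ 0` in the kit's `ρ`-form (res-type-100's B4a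
`exists_centredConeLift_three`); ANY cone ideal sheaf `K₀` with `K₀_{j x} = ((ι_*Φ)(c))`; and the cone point `y′ ∈ F₂` over `x`
with its DOWNSTAIRS T-FRAME-AT presentation on the chart `c̄₀` in which all `c̄_l/c̄₀ ∈ 𝔔` (`y′ = [1:0:0]`). CONCLUSION: at every
point `z` of `supp (E ⊔ St_{τ₁} K₀)` over the closed point with `z ≠ j₂ y′`, the quotient stalk `𝒪_{X₁,z} ⧸ (E ⊔ St K₀)_z` is a
regular local ring and `dim (𝒪_{X₁,z} ⧸ (E ⊔ St K₀)_z) + 2 = dim 𝒪_{X₁,z}` — i.e. `TCPlus.Member` clause (v) with `excl = {y′}`.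
[cite: Matsumura1987, Thm. 14.2; StacksProject, Tag 0804] [OURS · L1 W4.5b] -/
theorem isRegularLocalRing_quotient_carrierDelta_of_ne_conePoint (k : Type) [Field k]
    (O : Type) [CommRing O] [IsDomain O] [IsDiscreteValuationRing O] (θ : O →+* k) (hθ : Function.Surjective θ)
    {X' : Scheme.{0}} (r' : X' ⟶ Spec (.of O)) [IsSeparated r'] [IsLocallyNoetherian X']
    (s : Spec (.of O) ⟶ X') (hs : s ≫ r' = 𝟙 _)
    {F₁ : Scheme.{0}} (j : F₁ ⟶ X') (t : F₁ ⟶ Spec (.of k))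
    (hsq : IsPullback j t r' (Spec.map (CommRingCat.ofHom θ)))
    (x : F₁) (hx : IsClosed ({x} : Set F₁)) (hsx : s (IsLocalRing.closedPoint O) = j x)
    {X₁ : Scheme.{0}} (τ₁ : X₁ ⟶ X') (hτ₁ : IsBlowup τ₁ s.ker)
    {F₂ : Scheme.{0}} (υ : F₂ ⟶ F₁) (hυ : IsBlowup υ (vanishingIdeal (⟨{x}, hx⟩ : Closeds F₁)))
    (j₂ : F₂ ⟶ X₁) (t₂ : F₂ ⟶ Spec (.of k))
    (hsq₂ : IsPullback j₂ t₂ (τ₁ ≫ r') (Spec.map (CommRingCat.ofHom θ)))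
    (hcomm : j₂ ≫ τ₁ = υ ≫ j)
    (hcarrier : (s.ker.comap τ₁).comap j₂ = (vanishingIdeal (⟨{x}, hx⟩ : Closeds F₁)).comap υ)
    -- the frame at `j x`
    (c : Fin 3 → X'.presheaf.stalk (j x)) (hcI : Ideal.span (Set.range c) = stalkIdeal s.ker (j x))
    (hqr : IsQuasiRegular c) [IsDomain (X'.presheaf.stalk (j x) ⧸ Ideal.span (Set.range c))]
    (θR : (X'.presheaf.stalk (j x) ⧸ Ideal.span (Set.range c)) ≃+* O)
    (hθR : ∀ b : O, θR (Ideal.Quotient.mk _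
      (((Scheme.ΓSpecIso (.of O)).inv ≫ r'.appTop ≫ X'.presheaf.Γgerm (j x)).hom b)) = b)
    (h𝔪 : ∀ ϖ : O, Irreducible ϖ →
      Ideal.span (Set.range c) ⊔ Ideal.span {((Scheme.ΓSpecIso (.of O)).inv ≫ r'.appTop ≫ X'.presheaf.Γgerm (j x)).hom ϖ} =
        maximalIdeal (X'.presheaf.stalk (j x)) ∧
      ((Scheme.ΓSpecIso (.of O)).inv ≫ r'.appTop ≫ X'.presheaf.Γgerm (j x)).hom ϖ ∉ Ideal.span (Set.range c))
    -- the cone form: degree `d`, `ι_*Φ ≢ 0 mod (c)`, Δ-clause on the charts `i ≠ 0` (kit `ρ`-form)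
    {d : ℕ} (Φ : MvPolynomial (Fin 3) O) (hΦd : Φ.IsHomogeneous d)
    (hΦc : MvPolynomial.map (Ideal.Quotient.mk (Ideal.span (Set.range c)))
      (MvPolynomial.map ((Scheme.ΓSpecIso (.of O)).inv ≫ r'.appTop ≫ X'.presheaf.Γgerm (j x)).hom Φ) ≠ 0)
    (hΔ : ∀ (ρ : X'.presheaf.stalk (j x) →+* O),
      ρ.comp ((Scheme.ΓSpecIso (.of O)).inv ≫ r'.appTop ≫ X'.presheaf.Γgerm (j x)).hom = RingHom.id O →
      ∀ (i : Fin 3), i ≠ 0 → ∀ (ϖ : O), Irreducible ϖ →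
      ∀ (Q : Ideal (MvPolynomial {l : Fin 3 // l ≠ i} O ⧸ Ideal.span {MvPolynomial.map ρ
        (dehomogenize i (MvPolynomial.map
          ((Scheme.ΓSpecIso (.of O)).inv ≫ r'.appTop ≫ X'.presheaf.Γgerm (j x)).hom Φ))})) [Q.IsPrime],
        Ideal.Quotient.mk _ (MvPolynomial.C ϖ : MvPolynomial {l : Fin 3 // l ≠ i} O) ∈ Q →
          IsRegularLocalRing (Localization.AtPrime Q))
    -- the cone ideal sheaf
    (K₀ : X'.IdealSheafData)
    (hK : stalkIdeal K₀ (j x) = Ideal.span {MvPolynomial.eval c (MvPolynomial.map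
      ((Scheme.ΓSpecIso (.of O)).inv ≫ r'.appTop ≫ X'.presheaf.Γgerm (j x)).hom Φ)})
    -- the cone point downstairs: T-FRAME-AT presentation (`y′ = [1:0:0]` in the frame `c̄ = j♯ c`)
    (y' : F₂) (hy' : υ y' = x)
    (hvert : ∃ (𝔔 : PrimeSpectrum (blowupAlgebra (Ideal.span (Set.range fun i => (j.stalkMap x).hom (c i)))
          ((j.stalkMap x).hom (c 0))))
        (χ : blowupAlgebra (Ideal.span (Set.range fun i => (j.stalkMap x).hom (c i))) ((j.stalkMap x).hom (c 0)) →+*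
          F₂.presheaf.stalk y')
        (e : F₂.presheaf.stalk y' ≃+* Localization.AtPrime 𝔔.asIdeal),
        (∀ a, χ (algebraMap _ _ a) =
          ((F₁.presheaf.stalkCongr (Inseparable.of_eq hy')).inv ≫ υ.stalkMap y').hom a) ∧
        @IsLocalization.AtPrime _ _ (F₂.presheaf.stalk y') _ χ.toAlgebra 𝔔.asIdeal _ ∧
        (∀ b, e (χ b) = algebraMap _ (Localization.AtPrime 𝔔.asIdeal) b) ∧
        𝔔.asIdeal.comap (algebraMap _ (blowupAlgebra (Ideal.span (Set.range fun i => (j.stalkMap x).hom (c i)))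
          ((j.stalkMap x).hom (c 0)))) = maximalIdeal (F₁.presheaf.stalk x) ∧
        ∀ (l : {l : Fin 3 // l ≠ 0}) (y : blowupAlgebra (Ideal.span (Set.range fun i => (j.stalkMap x).hom (c i)))
            ((j.stalkMap x).hom (c 0))),
          (y : Localization.Away ((j.stalkMap x).hom (c 0))) =
            algebraMap _ (Localization.Away ((j.stalkMap x).hom (c 0))) ((j.stalkMap x).hom (c l.1)) *
              IsLocalization.Away.invSelf ((j.stalkMap x).hom (c 0)) → y ∈ 𝔔.asIdeal)
    -- the point
    (z : X₁) (hz : z ∈ ((s.ker.comap τ₁ ⊔ strictTransformIdeal τ₁ s.ker K₀).support : Set X₁))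
    (hzs : (τ₁ ≫ r') z = IsLocalRing.closedPoint O) (hne : z ≠ j₂ y') :
    IsRegularLocalRing (X₁.presheaf.stalk z ⧸ stalkIdeal (s.ker.comap τ₁ ⊔ strictTransformIdeal τ₁ s.ker K₀) z) ∧
      ringKrullDim (X₁.presheaf.stalk z ⧸ stalkIdeal (s.ker.comap τ₁ ⊔ strictTransformIdeal τ₁ s.ker K₀) z) + 2 =
        ringKrullDim (X₁.presheaf.stalk z) := by
  classical
  obtain ⟨𝔔, χ, -, hχ, hloc, -, h𝔔, hfr⟩ := hvert
  obtain ⟨ϖ, hϖ⟩ := IsDiscreteValuationRing.exists_irreducible O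
  have hϖO : ϖ ∈ maximalIdeal O := by rw [hϖ.maximalIdeal_eq]; exact Ideal.mem_span_singleton_self ϖ
  haveI : IsProper τ₁ := hτ₁.isProper
  haveI : IsLocallyNoetherian X₁ := LocallyOfFiniteType.isLocallyNoetherian τ₁
  haveI : IsClosedImmersion (Spec.map (CommRingCat.ofHom θ)) := IsClosedImmersion.spec_of_surjective _ hθ
  haveI : IsClosedImmersion j := MorphismProperty.IsStableUnderBaseChange.of_isPullback hsq.flip inferInstance
  obtain ⟨h𝔪ϖ, -⟩ := h𝔪 ϖ hϖ
  have hϖ𝔪 : ((Scheme.ΓSpecIso (.of O)).inv ≫ r'.appTop ≫ X'.presheaf.Γgerm (j x)).hom ϖ ∈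
      maximalIdeal (X'.presheaf.stalk (j x)) := h𝔪ϖ ▸ Ideal.mem_sup_right (Ideal.mem_span_singleton_self _)
  have hpJ : j x ∈ (s.ker.support : Set X') := by
    obtain ⟨-, -, -, hsupp⟩ := section_isClosedImmersion_and_isRegular_ker O X' r' s hs
    rw [hsupp, ← hsx]; exact Set.mem_range_self _
  have hρ : (θR.toRingHom.comp (Ideal.Quotient.mk (Ideal.span (Set.range c)))).comp
      ((Scheme.ΓSpecIso (.of O)).inv ≫ r'.appTop ≫ X'.presheaf.Γgerm (j x)).hom = RingHom.id O :=
    RingHom.ext fun b => hθR b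
  have hΦd' : (MvPolynomial.map ((Scheme.ΓSpecIso (.of O)).inv ≫ r'.appTop ≫ X'.presheaf.Γgerm (j x)).hom Φ).IsHomogeneous d :=
    hΦd.map _
  haveI : IsRegularRing (X'.presheaf.stalk (j x) ⧸ Ideal.span (Set.range c)) := IsRegularRing.of_ringEquiv θR.symm
  -- orientation `E ⊔ St K₀ = St K₀ ⊔ E` (the kit's)
  rw [show s.ker.comap τ₁ ⊔ strictTransformIdeal τ₁ s.ker K₀ = strictTransformIdeal τ₁ s.ker K₀ ⊔ s.ker.comap τ₁ from
    sup_comm _ _] at hz ⊢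
  have hzp : τ₁ z = j x := by
    rw [← hsx]; exact support_carrierDelta_inter_preimage_closedPoint_subset O r' s hs τ₁ _ ⟨hz, hzs⟩
  refine ⟨?_, ringKrullDim_quotient_carrierDelta_add_two hτ₁ _ z (j x) hzp hpJ c hcI hqr _ hΦd' hΦc hK hz⟩
  -- (1) `z = j₂ w` lies on the special fibre
  have hzr : z ∈ Set.range j₂ := by
    rw [range_eq_preimage_of_isPullback hsq₂, range_specMap_of_surjective_of_field θ hθ]; exact hzs
  obtain ⟨w, rfl⟩ := hzr
  -- (2) `υ w = x`, `w ≠ y′`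
  have hw : υ w = x := by
    apply (j.isClosedEmbedding).injective
    rw [← Scheme.Hom.comp_apply, ← hcomm, Scheme.Hom.comp_apply]; exact hzp
  have hwy : w ≠ y' := fun h => hne (h ▸ rfl)
  subst hw
  -- (3) downstairs: `w` is off the vertex of the frame `c̄` of `𝔪_x`, so some `c̄_l`, `l ≠ 0`, generates `(𝔪_x·𝒪_{F₂})_w`
  have hcb : Ideal.span (Set.range fun i => (j.stalkMap (υ w)).hom (c i)) =
      stalkIdeal (vanishingIdeal (⟨{υ w}, hx⟩ : Closeds F₁)) (υ w) := by
    rw [span_stalkMap_eq_maximalIdeal_of_model θ hθ r' j t hsq (υ w) ϖ hϖO c h𝔪ϖ, stalkIdeal_vanishingIdeal_singleton hx]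
  have hfr' : ∀ l : Fin 3, l ≠ 0 → blowupAlgebra.frac (fun i => (j.stalkMap (υ w)).hom (c i)) 0 l ∈ 𝔔.asIdeal :=
    fun l hl => hfr ⟨l, hl⟩ _ (blowupAlgebra.coe_frac _ 0 l)
  obtain ⟨l, hl0, hEw⟩ := exists_generator_ne_of_ne_vertex hυ hy' rfl _ hcb 0 𝔔 χ hχ hloc h𝔔 hfr' hwy
  have hEw' : stalkIdeal ((vanishingIdeal (⟨{υ w}, hx⟩ : Closeds F₁)).comap υ) w =
      Ideal.span {(υ.stalkMap w).hom ((j.stalkMap (υ w)).hom (c l))} := by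
    rw [hEw, CommRingCat.comp_apply, TopCat.Presheaf.stalkCongr_inv, stalkSpecializes_self_apply F₁.presheaf (υ w)]
  -- (4) transfer up the model square: `τ₁♯(c_l)` generates `E_z`
  have hcl : c l ∈ stalkIdeal s.ker (j (υ w)) := hcI ▸ Ideal.subset_span (Set.mem_range_self l)
  have hEz := stalkIdeal_eq_span_of_comap_eq_span hτ₁ j j₂ υ hcomm hυ.isEffectiveCartier hcarrier w hzp hcl hEw'
  -- (5) clause (v) on the chart `c_l` (Δ-clause for `ρ = θR ∘ mk`)
  refine isRegularLocalRing_stalk_quotient_carrierDelta_of_generator hτ₁ K₀ (j₂ w) (j (υ w)) hzp hpJ c hcI hqr _ hΦd' hΦc hK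
    (r'.appTop.hom ((Scheme.ΓSpecIso (.of O)).inv.hom ϖ)) hϖ𝔪 θR l hEz (fun 𝔓 _ h𝔓 => ?_) hz
  have hθϖ : θR (Ideal.Quotient.mk _ ((X'.presheaf.Γgerm (j (υ w))).hom (r'.appTop.hom ((Scheme.ΓSpecIso (.of O)).inv.hom ϖ)))) =
      ϖ := hθR ϖ
  rw [hθϖ] at h𝔓
  exact hΔ _ hρ l hl0 ϖ hϖ 𝔓 h𝔓

end Summit.ResolutionOfSingularities.ResolutionOfSingularities.Cruxes.EquisingularLiftNat.Sections

end
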